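import Summits.Schanuel.Schanuel.Theorems.SoloInformedRoyAdditiveGelfond
import HarnessLib.Audit.Tags

/-!
# Roy's additive small value estimates: `Transcendental` is necessary (soloist)

Soloist file (`solo-Schanuel-informed`, s149, 2026-08-29), companion of
`SoloInformedRoyAdditiveDirichlet` (the node `RoyAdditiveDirichletExponent`) and
`SoloInformedRoyAdditiveGelfond` (the one-point Gel'fond ceiling).  Source: the remark closing the
docstring of `RoyAdditiveDirichletExponent` ([Roy2010 = D. Roy, *Small value estimates for the
additive group*, Int. J. Number Theory **6** (2010), arXiv:0708.2307] assumes `ξ` transcendental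
throughout Thm 1.1; the exact-zero construction below is folklore).

## What is proved

For `ξ ∈ ℂ` ALGEBRAIC (`IsAlgebraic ℤ ξ`), `0 ≤ σ, 0 ≤ τ`, `σ + τ < 1`, `σ + τ < β`: for EVERY `ν`
the set `RoyAdditiveSmall ξ β σ τ ν n` is non-empty for all large `n`
(`royAdditiveSmall_nonempty_eventually_of_isAlgebraic`), hence `royAdditiveSVEExponents ξ β σ τ = ∅`
(`royAdditiveSVEExponents_eq_empty_of_isAlgebraic`); so `Transcendental ℚ ξ` cannot be dropped
from `RoyAdditiveDirichletExponent` (`not_royAdditiveDirichletExponent_without_hyp`, witness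
`ξ = 0`), and with the one-point Gel'fond ceiling the exponent set DETECTS TRANSCENDENCE
(`royAdditiveSVEExponents_nonempty_iff_transcendental`, `β > 1`).  The witness at level `n` is the
EXACT ZERO `Q_n = ∏_{i ≤ I, j ≤ J} m_i`, `m_i = scaleRoots m i = i^d m(T/i)` (`I = ⌊n^σ⌋`,
`J = ⌊n^τ⌋`, `d = deg m`, `m(ξ) = 0`): `(T - iξ)^{J+1} ∣ Q_n`, so every `Q_n^{[j]}`, `j ≤ J`,
vanishes at every `iξ`, `i ≤ I`; `deg Q_n ≤ 4d·n^{σ+τ} ≤ n` and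
`log H(Q_n) ≤ (I+1)(J+1)·log((d+1)H(m)(I+1)^d) = O(n^{σ+τ} log n) ≤ n^β` for large `n`.
§1 heights of products (`polyHeight_mul_le`); §2 the witness (`prod_scaleRoots_bounds`,
`aeval_hasseDeriv_prod_scaleRoots_eq_zero`); §3 budget and conclusions; §4 the dichotomy.
-/

namespace Summit.Schanuel.Schanuel.Theorems

open Filter Polynomial Finset

/-! ## §1 Heights of products -/

/-- A uniform bound on `natAbs` of the coefficients bounds the height. -/
theorem polyHeight_le_of_forall_natAbs_le {P : ℤ[X]} {H : ℕ} (h : ∀ k, (P.coeff k).natAbs ≤ H) :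
    polyHeight P ≤ H :=
  polyHeight_le_of_forall_abs_le fun k => by
    rw [Int.abs_eq_natAbs]
    exact_mod_cast h k

/-- `H(1) ≤ 1`. -/
theorem polyHeight_one_le : polyHeight (1 : ℤ[X]) ≤ 1 :=
  polyHeight_le_of_forall_natAbs_le fun k => by
    rw [coeff_one]
    split_ifs <;> simp

/-- Coefficients of a product: `|(fg)_k| ≤ (deg f + 1)·H(f)·H(g)`. -/
theorem natAbs_coeff_mul_le_polyHeight (f g : ℤ[X]) (k : ℕ) :
    ((f * g).coeff k).natAbs ≤ (f.natDegree + 1) * polyHeight f * polyHeight g := by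
  rw [coeff_mul]
  set s := (antidiagonal k).filter (fun x : ℕ × ℕ => x.1 ≤ f.natDegree) with hs
  have hvan : ∀ x ∈ antidiagonal k,
      (f.coeff x.1).natAbs * (g.coeff x.2).natAbs ≠ 0 → x.1 ≤ f.natDegree := by
    intro x _ hx
    by_contra hlt
    rw [coeff_eq_zero_of_natDegree_lt (not_le.mp hlt)] at hx
    simp at hx
  have hcard : s.card ≤ f.natDegree + 1 := by
    calc s.card ≤ ((range (f.natDegree + 1)).image (fun i => (i, k - i))).card := by
          refine Finset.card_le_card fun x hx => ?_
          simp only [hs, Finset.mem_filter, Finset.HasAntidiagonal.mem_antidiagonal] at hx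
          rw [Finset.mem_image]
          refine ⟨x.1, Finset.mem_range.mpr (Nat.lt_succ_of_le hx.2), Prod.ext rfl ?_⟩
          show k - x.1 = x.2
          omega
      _ ≤ (range (f.natDegree + 1)).card := Finset.card_image_le
      _ = f.natDegree + 1 := Finset.card_range _
  calc (∑ x ∈ antidiagonal k, f.coeff x.1 * g.coeff x.2).natAbs
      ≤ ∑ x ∈ antidiagonal k, (f.coeff x.1 * g.coeff x.2).natAbs := Int.natAbs_sum_le _ _
    _ = ∑ x ∈ antidiagonal k, (f.coeff x.1).natAbs * (g.coeff x.2).natAbs := by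
        simp_rw [Int.natAbs_mul]
    _ = ∑ x ∈ s, (f.coeff x.1).natAbs * (g.coeff x.2).natAbs :=
        (Finset.sum_filter_of_ne hvan).symm
    _ ≤ s.card • (polyHeight f * polyHeight g) :=
        Finset.sum_le_card_nsmul _ _ _ fun x _ =>
          Nat.mul_le_mul (natAbs_coeff_le_polyHeight f x.1) (natAbs_coeff_le_polyHeight g x.2)
    _ ≤ (f.natDegree + 1) * (polyHeight f * polyHeight g) := by
        rw [smul_eq_mul]
        exact Nat.mul_le_mul_right _ hcard
    _ = (f.natDegree + 1) * polyHeight f * polyHeight g := (mul_assoc _ _ _).symm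

/-- **Height of a product**: `H(fg) ≤ (deg f + 1)·H(f)·H(g)`. -/
theorem polyHeight_mul_le (f g : ℤ[X]) :
    polyHeight (f * g) ≤ (f.natDegree + 1) * polyHeight f * polyHeight g :=
  polyHeight_le_of_forall_natAbs_le (natAbs_coeff_mul_le_polyHeight f g)

/-- Height of a finite product of polynomials of degree `≤ D` and height `≤ H`:
`H(∏_{i ∈ s} f_i) ≤ ((D+1)H)^{#s}`. -/
theorem polyHeight_prod_le {ι : Type*} (s : Finset ι) (f : ι → ℤ[X]) {D H : ℕ}
    (hD : ∀ i ∈ s, (f i).natDegree ≤ D) (hH : ∀ i ∈ s, polyHeight (f i) ≤ H) :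
    polyHeight (∏ i ∈ s, f i) ≤ ((D + 1) * H) ^ s.card := by
  classical
  induction s using Finset.induction_on with
  | empty => simpa using polyHeight_one_le
  | insert a s ha ih =>
    rw [Finset.prod_insert ha, Finset.card_insert_of_notMem ha, pow_succ']
    have hDa := hD a (Finset.mem_insert_self a s)
    have hHa := hH a (Finset.mem_insert_self a s)
    have ih' := ih (fun i hi => hD i (Finset.mem_insert_of_mem hi))
      (fun i hi => hH i (Finset.mem_insert_of_mem hi))
    calc polyHeight (f a * ∏ i ∈ s, f i)
        ≤ ((f a).natDegree + 1) * polyHeight (f a) * polyHeight (∏ i ∈ s, f i) :=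
          polyHeight_mul_le _ _
      _ ≤ (D + 1) * H * ((D + 1) * H) ^ s.card :=
          Nat.mul_le_mul (Nat.mul_le_mul (Nat.succ_le_succ hDa) hHa) ih'

/-! ## §2 The exact-zero witness `∏_{i ≤ I, j ≤ J} scaleRoots m i` -/

/-- Height of `m_i = scaleRoots m i` (`= i^d m(T/i)`) for `i ≤ B`: `H(m_i) ≤ H(m)·(B+1)^{deg m}`. -/
theorem polyHeight_scaleRoots_natCast_le (m : ℤ[X]) {i B : ℕ} (hi : i ≤ B) :
    polyHeight (scaleRoots m (i : ℤ)) ≤ polyHeight m * (B + 1) ^ m.natDegree := by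
  refine polyHeight_le_of_forall_natAbs_le fun k => ?_
  rw [coeff_scaleRoots, Int.natAbs_mul, Int.natAbs_pow, Int.natAbs_natCast]
  refine Nat.mul_le_mul (natAbs_coeff_le_polyHeight m k) ?_
  calc i ^ (m.natDegree - k) ≤ (B + 1) ^ (m.natDegree - k) :=
        Nat.pow_le_pow_left (hi.trans (Nat.le_succ B)) _
    _ ≤ (B + 1) ^ m.natDegree := Nat.pow_le_pow_right (Nat.succ_pos B) (Nat.sub_le _ _)

/-- The witness is non-zero, of degree `≤ (I+1)(J+1)·deg m` and height
`≤ ((deg m + 1)·H(m)·(I+1)^{deg m})^{(I+1)(J+1)}`. -/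
theorem prod_scaleRoots_bounds {m : ℤ[X]} (hm : m ≠ 0) (I J : ℕ) :
    (∏ p ∈ range (I + 1) ×ˢ range (J + 1), scaleRoots m (p.1 : ℤ)) ≠ 0 ∧
    (∏ p ∈ range (I + 1) ×ˢ range (J + 1), scaleRoots m (p.1 : ℤ)).natDegree ≤
        (I + 1) * (J + 1) * m.natDegree ∧
    polyHeight (∏ p ∈ range (I + 1) ×ˢ range (J + 1), scaleRoots m (p.1 : ℤ)) ≤
        ((m.natDegree + 1) * (polyHeight m * (I + 1) ^ m.natDegree)) ^ ((I + 1) * (J + 1)) := by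
  refine ⟨Finset.prod_ne_zero_iff.mpr fun p _ => scaleRoots_ne_zero hm _, ?_, ?_⟩
  · refine (natDegree_prod_le _ _).trans ?_
    have : ∑ p ∈ range (I + 1) ×ˢ range (J + 1), (scaleRoots m (p.1 : ℤ)).natDegree =
        ∑ _p ∈ range (I + 1) ×ˢ range (J + 1), m.natDegree :=
      Finset.sum_congr rfl fun p _ => natDegree_scaleRoots _ _
    rw [this, Finset.sum_const, smul_eq_mul, Finset.card_product, Finset.card_range,
      Finset.card_range]
  · have h := polyHeight_prod_le (range (I + 1) ×ˢ range (J + 1))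
      (fun p : ℕ × ℕ => scaleRoots m (p.1 : ℤ)) (D := m.natDegree)
      (H := polyHeight m * (I + 1) ^ m.natDegree)
      (fun p _ => (natDegree_scaleRoots _ _).le)
      (fun p hp => polyHeight_scaleRoots_natCast_le m (B := I)
        (Nat.lt_succ_iff.mp (Finset.mem_range.mp (Finset.mem_product.mp hp).1)))
    rwa [Finset.card_product, Finset.card_range, Finset.card_range] at h

/-- `hasseDeriv` commutes with `map`. -/
theorem map_hasseDeriv_eq (Q : ℤ[X]) (j : ℕ) :
    (hasseDeriv j Q).map (algebraMap ℤ ℂ) = hasseDeriv j (Q.map (algebraMap ℤ ℂ)) := by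
  ext k
  simp [coeff_map, hasseDeriv_coeff]

/-- If `(X - c)^{J+1} ∣ F` in `ℂ[X]` and `j ≤ J`, the divided derivative `F^{[j]}` vanishes
at `c`. -/
theorem eval_hasseDeriv_eq_zero_of_pow_dvd {F : ℂ[X]} {c : ℂ} {J j : ℕ} (hj : j ≤ J)
    (hdvd : (X - C c) ^ (J + 1) ∣ F) : (hasseDeriv j F).eval c = 0 := by
  have h1 : (X - C c) ^ (J + 1 - j) ∣ derivative^[j] F :=
    pow_sub_dvd_iterate_derivative_of_pow_dvd j hdvd
  have h2 : (X - C c) ∣ derivative^[j] F :=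
    (dvd_pow_self (X - C c) (by omega)).trans h1
  have h3 : (derivative^[j] F).eval c = 0 := (dvd_iff_isRoot.mp h2)
  have h4 : (j.factorial • hasseDeriv j) F = derivative^[j] F :=
    congrFun (factorial_smul_hasseDeriv (R := ℂ) (k := j)) F
  rw [LinearMap.smul_apply] at h4
  have h5 : (j.factorial • hasseDeriv j F).eval c = 0 := by rw [h4, h3]
  rw [eval_smul, smul_eq_zero] at h5
  exact h5.resolve_left (Nat.factorial_ne_zero j)

/-- **The divided derivatives of the witness vanish at the points `iξ`**: for `m(ξ) = 0`,
`i ≤ I`, `j ≤ J`, `(∏_{p ∈ [0,I]×[0,J]} m_{p.1})^{[j]}(iξ) = 0`. -/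
theorem aeval_hasseDeriv_prod_scaleRoots_eq_zero {m : ℤ[X]} {ξ : ℂ} (hmξ : aeval ξ m = 0)
    {I J i j : ℕ} (hi : i ≤ I) (hj : j ≤ J) :
    aeval ((i : ℂ) * ξ)
      (hasseDeriv j (∏ p ∈ range (I + 1) ×ˢ range (J + 1), scaleRoots m (p.1 : ℤ))) = 0 := by
  set Q := ∏ p ∈ range (I + 1) ×ˢ range (J + 1), scaleRoots m (p.1 : ℤ) with hQ
  set c : ℂ := (i : ℂ) * ξ with hc
  -- `m_i^{J+1} ∣ Q`
  have hsub : ({i} : Finset ℕ) ×ˢ range (J + 1) ⊆ range (I + 1) ×ˢ range (J + 1) :=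
    Finset.product_subset_product_left (Finset.singleton_subset_iff.mpr
      (Finset.mem_range.mpr (Nat.lt_succ_of_le hi)))
  have hdvdZ : scaleRoots m (i : ℤ) ^ (J + 1) ∣ Q := by
    have h := Finset.prod_dvd_prod_of_subset _ _ (fun p : ℕ × ℕ => scaleRoots m (p.1 : ℤ)) hsub
    rw [Finset.prod_product, Finset.prod_singleton] at h
    simp only [Finset.prod_const, Finset.card_range] at h
    exact h
  -- the root `c` of `m_i`
  have hroot : aeval c (scaleRoots m (i : ℤ)) = 0 := by
    have h := scaleRoots_aeval_eq_zero (r := (i : ℤ)) hmξ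
    simpa [hc] using h
  have hlin : (X - C c) ∣ (scaleRoots m (i : ℤ)).map (algebraMap ℤ ℂ) := by
    rw [dvd_iff_isRoot, IsRoot, eval_map_algebraMap, hroot]
  have hdvdC : (X - C c) ^ (J + 1) ∣ Q.map (algebraMap ℤ ℂ) := by
    refine (pow_dvd_pow_of_dvd hlin (J + 1)).trans ?_
    rw [← Polynomial.map_pow]
    exact Polynomial.map_dvd _ hdvdZ
  rw [← eval_map_algebraMap, map_hasseDeriv_eq]
  exact eval_hasseDeriv_eq_zero_of_pow_dvd hj hdvdC

/-! ## §3 The budget and the conclusions -/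

/-- The budget: for `0 ≤ σ, 0 ≤ τ`, `σ + τ < 1`, `σ + τ < β` and naturals `d`, `A ≥ 1`,
eventually `(⌊n^σ⌋+1)(⌊n^τ⌋+1)·d ≤ n` and
`(⌊n^σ⌋+1)(⌊n^τ⌋+1)·log(A·(⌊n^σ⌋+1)^d) ≤ n^β`. -/
theorem eventually_algebraic_budget {β σ τ : ℝ} (hσ : 0 ≤ σ) (hτ : 0 ≤ τ) (hστ : σ + τ < 1)
    (hβ : σ + τ < β) (d A : ℕ) (hA : 1 ≤ A) :
    ∀ᶠ n : ℕ in atTop,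
      ((⌊(n : ℝ) ^ σ⌋₊ + 1 : ℕ) : ℝ) * ((⌊(n : ℝ) ^ τ⌋₊ + 1 : ℕ) : ℝ) * d ≤ n ∧
      ((⌊(n : ℝ) ^ σ⌋₊ + 1 : ℕ) : ℝ) * ((⌊(n : ℝ) ^ τ⌋₊ + 1 : ℕ) : ℝ) *
        Real.log ((A : ℝ) * (((⌊(n : ℝ) ^ σ⌋₊ + 1 : ℕ) : ℝ)) ^ d) ≤ (n : ℝ) ^ β := by
  -- an auxiliary exponent `ε` with `σ + τ + ε < β`, `0 < ε ≤ 1`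
  obtain ⟨ε, hε0, hε1, hεβ⟩ : ∃ ε : ℝ, 0 < ε ∧ ε ≤ 1 ∧ σ + τ + ε < β :=
    ⟨min 1 ((β - σ - τ) / 2), lt_min one_pos (by linarith), min_le_left _ _,
      by linarith [min_le_right (1 : ℝ) ((β - σ - τ) / 2)]⟩
  have h1 : ∀ᶠ n : ℕ in atTop, (4 * (d : ℝ)) * (n : ℝ) ^ (σ + τ) ≤ (n : ℝ) ^ (1 : ℝ) :=
    eventually_const_mul_rpow_le_rpow hστ _
  have h2 : ∀ᶠ n : ℕ in atTop,
      (4 * (Real.log A + d * (2 / ε))) * (n : ℝ) ^ (σ + τ + ε) ≤ (n : ℝ) ^ β :=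
    eventually_const_mul_rpow_le_rpow hεβ _
  filter_upwards [h1, h2, eventually_ge_atTop 1] with n hn1 hn2 hn
  have hn' : (1 : ℝ) ≤ n := by exact_mod_cast hn
  have hn0 : (0 : ℝ) < n := by linarith
  -- `I + 1 ≤ 2 n^σ`, `J + 1 ≤ 2 n^τ`
  have hσ1 : (1 : ℝ) ≤ (n : ℝ) ^ σ := Real.one_le_rpow hn' hσ
  have hτ1 : (1 : ℝ) ≤ (n : ℝ) ^ τ := Real.one_le_rpow hn' hτ
  have hI : ((⌊(n : ℝ) ^ σ⌋₊ + 1 : ℕ) : ℝ) ≤ 2 * (n : ℝ) ^ σ := by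
    push_cast
    linarith [Nat.floor_le (Real.rpow_nonneg hn0.le σ)]
  have hJ : ((⌊(n : ℝ) ^ τ⌋₊ + 1 : ℕ) : ℝ) ≤ 2 * (n : ℝ) ^ τ := by
    push_cast
    linarith [Nat.floor_le (Real.rpow_nonneg hn0.le τ)]
  have hI1 : (1 : ℝ) ≤ ((⌊(n : ℝ) ^ σ⌋₊ + 1 : ℕ) : ℝ) := by
    push_cast; linarith [Nat.cast_nonneg (α := ℝ) ⌊(n : ℝ) ^ σ⌋₊]
  have hJ0 : (0 : ℝ) ≤ ((⌊(n : ℝ) ^ τ⌋₊ + 1 : ℕ) : ℝ) := Nat.cast_nonneg _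
  have hIJ : ((⌊(n : ℝ) ^ σ⌋₊ + 1 : ℕ) : ℝ) * ((⌊(n : ℝ) ^ τ⌋₊ + 1 : ℕ) : ℝ) ≤
      4 * (n : ℝ) ^ (σ + τ) := by
    rw [Real.rpow_add hn0]
    calc ((⌊(n : ℝ) ^ σ⌋₊ + 1 : ℕ) : ℝ) * ((⌊(n : ℝ) ^ τ⌋₊ + 1 : ℕ) : ℝ)
        ≤ (2 * (n : ℝ) ^ σ) * (2 * (n : ℝ) ^ τ) := mul_le_mul hI hJ hJ0 (by positivity)
      _ = 4 * ((n : ℝ) ^ σ * (n : ℝ) ^ τ) := by ring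
  have hIJ0 : (0 : ℝ) ≤ ((⌊(n : ℝ) ^ σ⌋₊ + 1 : ℕ) : ℝ) * ((⌊(n : ℝ) ^ τ⌋₊ + 1 : ℕ) : ℝ) :=
    by positivity
  constructor
  · -- degree budget
    rw [Real.rpow_one] at hn1
    calc ((⌊(n : ℝ) ^ σ⌋₊ + 1 : ℕ) : ℝ) * ((⌊(n : ℝ) ^ τ⌋₊ + 1 : ℕ) : ℝ) * d
        ≤ 4 * (n : ℝ) ^ (σ + τ) * d := mul_le_mul_of_nonneg_right hIJ (Nat.cast_nonneg d)
      _ = (4 * (d : ℝ)) * (n : ℝ) ^ (σ + τ) := by ring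
      _ ≤ n := hn1
  · -- height budget: `log (A (I+1)^d) = log A + d log (I+1)`, `log (I+1) ≤ (I+1)^ε/ε ≤ 2 n^ε/ε`
    have hA0 : (0 : ℝ) < A := by exact_mod_cast hA
    have hlogA : 0 ≤ Real.log A := Real.log_nonneg (by exact_mod_cast hA)
    have hI0 : (0 : ℝ) < ((⌊(n : ℝ) ^ σ⌋₊ + 1 : ℕ) : ℝ) := by linarith
    have hlog : Real.log ((A : ℝ) * (((⌊(n : ℝ) ^ σ⌋₊ + 1 : ℕ) : ℝ)) ^ d) =
        Real.log A + d * Real.log (((⌊(n : ℝ) ^ σ⌋₊ + 1 : ℕ) : ℝ)) := by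
      rw [Real.log_mul hA0.ne' (pow_ne_zero _ hI0.ne'), Real.log_pow]
    -- `log (I+1) ≤ (I+1)^ε / ε ≤ (2 n^σ)^ε / ε ≤ 2 n^ε / ε`  (`σ ≤ 1`, `ε ≤ 1`)
    have hlogI : Real.log (((⌊(n : ℝ) ^ σ⌋₊ + 1 : ℕ) : ℝ)) ≤ 2 * (n : ℝ) ^ ε / ε := by
      have h := Real.log_le_rpow_div hI0.le hε0
      refine h.trans (div_le_div_of_nonneg_right ?_ hε0.le)
      have hσle : σ ≤ 1 := by linarith
      have hnσ : (n : ℝ) ^ σ ≤ n := by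
        have := Real.rpow_le_rpow_of_exponent_le hn' hσle
        rwa [Real.rpow_one] at this
      have hIn : ((⌊(n : ℝ) ^ σ⌋₊ + 1 : ℕ) : ℝ) ≤ 2 * n := hI.trans (by linarith)
      calc ((⌊(n : ℝ) ^ σ⌋₊ + 1 : ℕ) : ℝ) ^ ε ≤ (2 * (n : ℝ)) ^ ε :=
            Real.rpow_le_rpow hI0.le hIn hε0.le
        _ = (2 : ℝ) ^ ε * (n : ℝ) ^ ε := Real.mul_rpow (by norm_num) hn0.le
        _ ≤ 2 * (n : ℝ) ^ ε := by
            refine mul_le_mul_of_nonneg_right ?_ (Real.rpow_nonneg hn0.le ε)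
            have := Real.rpow_le_rpow_of_exponent_le (by norm_num : (1 : ℝ) ≤ 2) hε1
            rwa [Real.rpow_one] at this
    have hnε : (0 : ℝ) ≤ (n : ℝ) ^ ε := Real.rpow_nonneg hn0.le ε
    have hnε1 : (1 : ℝ) ≤ (n : ℝ) ^ ε := Real.one_le_rpow hn' hε0.le
    have hsplit : (n : ℝ) ^ (σ + τ + ε) = (n : ℝ) ^ (σ + τ) * (n : ℝ) ^ ε := Real.rpow_add hn0 _ _
    have hstε : 0 ≤ (n : ℝ) ^ (σ + τ) := Real.rpow_nonneg hn0.le _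
    rw [hlog]
    calc ((⌊(n : ℝ) ^ σ⌋₊ + 1 : ℕ) : ℝ) * ((⌊(n : ℝ) ^ τ⌋₊ + 1 : ℕ) : ℝ) *
          (Real.log A + d * Real.log (((⌊(n : ℝ) ^ σ⌋₊ + 1 : ℕ) : ℝ)))
        ≤ (4 * (n : ℝ) ^ (σ + τ)) * (Real.log A + d * (2 * (n : ℝ) ^ ε / ε)) := by
          refine mul_le_mul hIJ ?_ ?_ (by positivity)
          · exact add_le_add le_rfl (mul_le_mul_of_nonneg_left hlogI (Nat.cast_nonneg d))
          · exact add_nonneg hlogA (mul_nonneg (Nat.cast_nonneg d) (Real.log_nonneg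
              (by exact_mod_cast Nat.le_add_left 1 _)))
      _ ≤ (4 * (n : ℝ) ^ (σ + τ)) * ((Real.log A + d * (2 / ε)) * (n : ℝ) ^ ε) := by
          refine mul_le_mul_of_nonneg_left ?_ (by positivity)
          have hdε : 0 ≤ (d : ℝ) * (2 / ε) := by positivity
          calc Real.log A + d * (2 * (n : ℝ) ^ ε / ε)
              = Real.log A * 1 + d * (2 / ε) * (n : ℝ) ^ ε := by ring
            _ ≤ Real.log A * (n : ℝ) ^ ε + d * (2 / ε) * (n : ℝ) ^ ε :=
                add_le_add (mul_le_mul_of_nonneg_left hnε1 hlogA) le_rfl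
            _ = (Real.log A + d * (2 / ε)) * (n : ℝ) ^ ε := by ring
      _ = (4 * (Real.log A + d * (2 / ε))) * (n : ℝ) ^ (σ + τ + ε) := by rw [hsplit]; ring
      _ ≤ (n : ℝ) ^ β := hn2

/-- **For algebraic `ξ` the small-value sets are eventually non-empty, for every `ν`**
(the exact-zero witness of §2). -/
theorem royAdditiveSmall_nonempty_eventually_of_isAlgebraic {ξ : ℂ} (hξ : IsAlgebraic ℤ ξ)
    {β σ τ : ℝ} (hσ : 0 ≤ σ) (hτ : 0 ≤ τ) (hστ : σ + τ < 1) (hβ : σ + τ < β) (ν : ℝ) :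
    ∀ᶠ n : ℕ in atTop, (RoyAdditiveSmall ξ β σ τ ν n).Nonempty := by
  obtain ⟨m, hm0, hmξ⟩ := hξ
  set d := m.natDegree with hd
  set A : ℕ := (d + 1) * polyHeight m with hA
  have hHm : polyHeight m ≠ 0 := fun h0 => by
    have h := natAbs_coeff_le_polyHeight m m.natDegree
    rw [h0, Nat.le_zero, Int.natAbs_eq_zero] at h
    exact hm0 (leadingCoeff_eq_zero.mp h)
  have hA1 : 1 ≤ A := Nat.one_le_iff_ne_zero.mpr (Nat.mul_ne_zero (Nat.succ_ne_zero d) hHm)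
  filter_upwards [eventually_algebraic_budget hσ hτ hστ hβ d A hA1] with n hbudget
  obtain ⟨hdeg, hht⟩ := hbudget
  set I := ⌊(n : ℝ) ^ σ⌋₊ with hI
  set J := ⌊(n : ℝ) ^ τ⌋₊ with hJ
  obtain ⟨hQ0, hQdeg, hQht⟩ := prod_scaleRoots_bounds hm0 I J
  refine ⟨∏ p ∈ range (I + 1) ×ˢ range (J + 1), scaleRoots m (p.1 : ℤ), hQ0, ?_, ?_, ?_⟩
  · -- degree
    have h : (((I + 1) * (J + 1) * d : ℕ) : ℝ) ≤ n := by push_cast at hdeg ⊢; exact hdeg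
    exact hQdeg.trans (by exact_mod_cast h)
  · -- height: `H(Q) ≤ (A (I+1)^d)^{(I+1)(J+1)} = exp((I+1)(J+1) log(A (I+1)^d)) ≤ exp(n^β)`
    have hB1 : (1 : ℝ) ≤ (A : ℝ) * (((I + 1 : ℕ) : ℝ)) ^ d := by
      have h1 : (1 : ℝ) ≤ A := by exact_mod_cast hA1
      have h2 : (1 : ℝ) ≤ (((I + 1 : ℕ) : ℝ)) ^ d :=
        one_le_pow₀ (by exact_mod_cast Nat.le_add_left 1 I)
      nlinarith
    have hB0 : (0 : ℝ) < (A : ℝ) * (((I + 1 : ℕ) : ℝ)) ^ d := by linarith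
    calc (polyHeight (∏ p ∈ range (I + 1) ×ˢ range (J + 1), scaleRoots m (p.1 : ℤ)) : ℝ)
        ≤ (((d + 1) * (polyHeight m * (I + 1) ^ d)) ^ ((I + 1) * (J + 1)) : ℕ) := by
          exact_mod_cast hQht
      _ = ((A : ℝ) * (((I + 1 : ℕ) : ℝ)) ^ d) ^ ((I + 1) * (J + 1)) := by
          rw [hA]; push_cast; ring
      _ = Real.exp ((((I + 1) * (J + 1) : ℕ) : ℝ) *
            Real.log ((A : ℝ) * (((I + 1 : ℕ) : ℝ)) ^ d)) := by
          rw [Real.exp_nat_mul, Real.exp_log hB0]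
      _ ≤ Real.exp ((n : ℝ) ^ β) := by
          rw [Real.exp_le_exp]
          push_cast at hht ⊢
          exact hht
  · -- the divided derivatives vanish at the points `iξ`
    intro i j hi hj
    have hi' : i ≤ I := Nat.le_floor hi
    have hj' : j ≤ J := Nat.le_floor hj
    rw [aeval_hasseDeriv_prod_scaleRoots_eq_zero hmξ hi' hj', norm_zero]
    exact (Real.exp_pos _).le

/-- **No small value estimate at an algebraic point**: for algebraic `ξ`, `0 ≤ σ, 0 ≤ τ`,
`σ + τ < 1`, `σ + τ < β`, the exponent set is EMPTY. -/
theorem royAdditiveSVEExponents_eq_empty_of_isAlgebraic {ξ : ℂ} (hξ : IsAlgebraic ℤ ξ)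
    {β σ τ : ℝ} (hσ : 0 ≤ σ) (hτ : 0 ≤ τ) (hστ : σ + τ < 1) (hβ : σ + τ < β) :
    royAdditiveSVEExponents ξ β σ τ = ∅ := by
  ext ν
  simp only [Set.mem_empty_iff_false, iff_false]
  intro hν
  have hν' : ∃ᶠ n : ℕ in atTop, ¬ (RoyAdditiveSmall ξ β σ τ ν n).Nonempty := hν
  exact hν' ((royAdditiveSmall_nonempty_eventually_of_isAlgebraic hξ hσ hτ hστ hβ ν).mono
    fun _ h => not_not_intro h)

/-- **`Transcendental` cannot be dropped from `RoyAdditiveDirichletExponent`**: the same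
statement for ALL `ξ ∈ ℂ` is false (witness `ξ = 0`, `β = 2`, `σ = τ = 0`, `ν = 4`). -/
theorem not_royAdditiveDirichletExponent_without_hyp :
    ¬ ∀ ξ : ℂ, ∀ β σ τ : ℝ, 0 ≤ σ → 0 ≤ τ → 1 < β → σ + τ < 1 →
      Set.Ioi (1 + β - σ - τ) ⊆ royAdditiveSVEExponents ξ β σ τ := by
  intro h
  have h0 : IsAlgebraic ℤ (0 : ℂ) := isAlgebraic_zero
  have hsub := h 0 2 0 0 le_rfl le_rfl (by norm_num) (by norm_num)
  rw [royAdditiveSVEExponents_eq_empty_of_isAlgebraic h0 le_rfl le_rfl (by norm_num)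
    (by norm_num)] at hsub
  exact hsub (show (4 : ℝ) ∈ Set.Ioi (1 + 2 - 0 - 0) by norm_num)

/-! ## §4 The exponent set detects transcendence -/

/-- `¬ Transcendental ℚ ξ` (i.e. `ξ` algebraic over `ℚ`, equivalently over `ℤ`) ⟹ the exponent
set is empty. -/
theorem royAdditiveSVEExponents_eq_empty_of_not_transcendental {ξ : ℂ}
    (hξ : ¬ Transcendental ℚ ξ) {β σ τ : ℝ} (hσ : 0 ≤ σ) (hτ : 0 ≤ τ) (hστ : σ + τ < 1)
    (hβ : σ + τ < β) : royAdditiveSVEExponents ξ β σ τ = ∅ := by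
  have hξ' : IsAlgebraic ℚ ξ := by
    unfold Transcendental at hξ
    push Not at hξ
    exact hξ
  exact royAdditiveSVEExponents_eq_empty_of_isAlgebraic
    ((IsFractionRing.isAlgebraic_iff ℤ ℚ ℂ).mpr hξ') hσ hτ hστ hβ

/-- **The additive small-value exponent set detects transcendence**: for `β > 1`, `0 ≤ σ, 0 ≤ τ`,
`σ + τ < 1`, `royAdditiveSVEExponents ξ β σ τ` is NON-EMPTY iff `ξ` is transcendental (then it
contains `(1 + β, ∞)` by the one-point Gel'fond ceiling; otherwise it is empty by the exact-zero
witness).  The OPEN node `RoyAdditiveDirichletExponent` asks WHERE it begins, not whether. -/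
theorem royAdditiveSVEExponents_nonempty_iff_transcendental {ξ : ℂ} {β σ τ : ℝ} (hσ : 0 ≤ σ)
    (hτ : 0 ≤ τ) (hστ : σ + τ < 1) (hβ : 1 < β) :
    (royAdditiveSVEExponents ξ β σ τ).Nonempty ↔ Transcendental ℚ ξ := by
  constructor
  · intro hne
    by_contra hξ
    rw [royAdditiveSVEExponents_eq_empty_of_not_transcendental hξ hσ hτ hστ (by linarith)] at hne
    exact Set.not_nonempty_empty hne
  · intro hξ
    exact ⟨1 + β + 1, Ioi_subset_royAdditiveSVEExponents hξ τ hσ hβ.le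
      (Set.mem_Ioi.mpr (by linarith))⟩

end Summit.Schanuel.Schanuel.Theorems
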